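import Summits.MatrixMultiplication.MatrixMultiplication.Theorems.AbelianSTPPCensusTAStatDDefs

/-!
# T_A certificate, fourth range `6191 … 6379` (static t*-indexed linear checker, free budget parameter, two-member fallback): kernel evaluation, domination of the table, volumes `2892 … 3519`

Cell mm-stpp (rung F-M1), threshold T_A = `τ = 2.371`; checker in `AbelianSTPPCensusTAStatDDefs.lean`, table in `AbelianSTPPCensusTAStatDData.lean`.
`decide` with kernel reduction (standard axioms; no `native_decide`), `Elab.async false`; consumed by `TAStatD.checkV_sound` / `TAStatD.domV_sound` / `TAStatD.m2V_sound`
in the leaf `AbelianSTPPCensusLeafTA6379Closed.lean`.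
WHAT THIS IS NOT: arithmetic on shape lists only; no statement about STPP families or `ω`.
-/

set_option linter.dupNamespace false
set_option autoImplicit false
set_option Elab.async false

namespace Summit.MatrixMultiplication.MatrixMultiplication.Theorems.TAStatD

set_option maxHeartbeats 0 in
/-- Domination chunk: every sorted candidate shape of the volumes `2892 … 3191` (2576 shapes) is dominated by the table (`domX`). [original] -/
theorem dom2892 : TAStatD.domV 300 2892 = true := by decide +kernel

set_option maxHeartbeats 0 in
/-- Completeness chunk: on the volumes `2892 … 3191` every sorted candidate shape whose bucket is flagged lies in that bucket's second-member list (`m2V`). [original] -/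
theorem m2c2892 : TAStatD.m2V 300 2892 = true := by decide +kernel

set_option maxHeartbeats 0 in
/-- Domination chunk: every sorted candidate shape of the volumes `3192 … 3519` (2572 shapes) is dominated by the table (`domX`). [original] -/
theorem dom3192 : TAStatD.domV 328 3192 = true := by decide +kernel

set_option maxHeartbeats 0 in
/-- Completeness chunk: on the volumes `3192 … 3519` every sorted candidate shape whose bucket is flagged lies in that bucket's second-member list (`m2V`). [original] -/
theorem m2c3192 : TAStatD.m2V 328 3192 = true := by decide +kernel

end Summit.MatrixMultiplication.MatrixMultiplication.Theorems.TAStatD
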